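import Summits.CriticalPhenomena.Ising3DConformalLimit.Theorems.PerfectScreeningGaussianLimitNotScreenedDepletionBound
import Literature.Probability.LatticeModels.WeightedCurrentsSwitching
import Literature.Probability.LatticeModels.WeightedCurrentsIdentities
import Literature.Probability.LatticeModels.DepletedPairConnection
import Literature.Probability.LatticeModels.SourcedDoubleCurrentsSwitching
import HarnessLib

/-!
# Crux `CoulombImpliesNontrivial` (stmt-CriticalPhenomena-13885, route PerfectScreening r3), line
# `merging-is-expected-screening`: registered stub `stub_essentialityCriterion`
# (the essentiality criterion: disconnection mass of the nested switching lemma ⟹ depletion)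

In the free box `Λ_L ⊂ ℤ³` at `β_c(3)`, for `c, e ∈ Λ_L` outside a finite set of sites `C` and
`0 ≤ c'`: write `T = boxSources 3 L C` (the vertices of `C` in `Λ_{L+1}`), `G₁ = offGraph Λ T` (the
free box graph with every bond meeting `C` removed), `Z_{G₁}[A] = ecurrentSumIn G₁ K A`,
`Z[A] = ecurrentSum K A` (`K ≡ β_c(3)`), and
`DISC = ∑_{(n₁,n₂)} 𝟙[n₁ ⊆ E(G₁), ∂n₁ = ∅] w(n₁) 𝟙[∂n₂ = {c}∆{e}] w(n₂) 𝟙[c ↮ e through (n₁+n₂)|_{E(G₁)}]`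
(the connection read on the lifted trace `liftBonds 3 L ((n₁+n₂).tracedIn G₁)`). If
`c' · Z_{G₁}[∅] · Z[ce] ≤ DISC` then `⟨σ_cσ_e⟩_{Λ_L∖C} ≤ (1 − c') ⟨σ_cσ_e⟩_{Λ_L}` (`defectG ≤ (1 − c') boxG`).

Proof. The nested switching lemma (Aizenman–Duminil-Copin–Sidoravicius 2015, Lemma 2.2; tree
`Current.etsum_switching_univ`, packaged with the complementary event as
`Current.ecurrentSumIn_empty_mul_ecurrentSum_pair`) gives the exact identity
`Z_{G₁}[∅] Z[ce] = Z_{G₁}[ce] Z[∅] + DISC`; with the hypothesis,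
`Z_{G₁}[ce] Z[∅] + c' Z_{G₁}[∅] Z[ce] ≤ Z_{G₁}[∅] Z[ce]`, i.e. `Z_{G₁}[ce]/Z_{G₁}[∅] ≤ (1 − c') Z[ce]/Z[∅]`
after division by `Z_{G₁}[∅] Z[∅] > 0`; the box dictionary of
`…GaussianLimitNotScreenedDepletionBound` (`toReal_offRatio_eq_defectG`, `boxG_eq_toReal_div`)
identifies the two sides with `⟨σ_cσ_e⟩_{Λ_L∖C}` and `(1 − c')⟨σ_cσ_e⟩_{Λ_L}`. Everything is proved;
nothing is defined or cited as a fact. [AizenmanDuminilCopinSidoraviciusCMP2015, Lemma 2.2]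
-/

noncomputable section

namespace Summit.CriticalPhenomena.Ising3DConformalLimit.Cruxes.CoulombImpliesNontrivial.MergingIsExpectedScreening

open Filter Topology Set MeasureTheory Finset
open Literature.Probability.LatticeModels Literature.Probability.Percolation
open Summit.CriticalPhenomena.Ising3DConformalLimit.Cruxes.IsingEuclidUpgradeR4NonGaussian.FreeCovarianceDeltaDichotomy
  (lat boxG)
open Summit.CriticalPhenomena.Ising3DConformalLimit.Cruxes.GaussianLimitNotScreened.KaramataAmplitudeBlindMerging
  (IsSpreadDefect defectG)
open scoped symmDiff
open scoped ENNReal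
open Summit.CriticalPhenomena.Ising3DConformalLimit.Cruxes.GaussianLimitNotScreened.KaramataAmplitudeBlindMerging
  (toReal_offRatio_eq_defectG boxG_eq_toReal_div)

/-- The free defect only matters inside the box: `⟨σ_cσ_e⟩_{Λ_L ∖ (C ∩ Λ_{L+1})} = ⟨σ_cσ_e⟩_{Λ_L ∖ C}`,
because `Λ_L ∖ (C ∩ Λ_{L+1}) = Λ_L ∖ C` (`Λ_L ⊆ Λ_{L+1}`); here `C ∩ Λ_{L+1}` is written as the image
of `boxSources 3 L C` under `↥Λ_{L+1} ↪ ℤ³`. [folklore] -/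
theorem defectG_map_boxSources (L : ℕ) (C : Finset (Site 3)) (c e : Site 3) :
    defectG L ((boxSources 3 L C).map (boxEmb 3 L)) c e = defectG L C c e := by
  unfold Summit.CriticalPhenomena.Ising3DConformalLimit.Cruxes.GaussianLimitNotScreened.KaramataAmplitudeBlindMerging.defectG
  congr 1
  ext x
  simp only [Finset.mem_sdiff, Finset.mem_map, mem_boxSources_iff, boxEmb_apply]
  constructor
  · rintro ⟨hx, h⟩
    exact ⟨hx, fun hxC => h ⟨⟨x, box_subset_box_succ 3 L hx⟩, hxC, rfl⟩⟩
  · rintro ⟨hx, hxC⟩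
    exact ⟨hx, fun ⟨a, ha, hax⟩ => hxC (hax ▸ ha)⟩

/-- The disconnection event read on the lifted restricted trace is the complement of the tree's
`Current.connIn`: `𝟙[liftBonds ((n₁+n₂)|_{E(G₁)}) ∉ {c ↔ e}] = 𝟙[(n₁+n₂) ∉ connIn G₁ c e]`
(`liftBonds_mem_openConn_iff`). [folklore] -/
theorem indicator_liftBonds_notMem_openConn (L : ℕ) (G₁ : SimpleGraph (BoxVertex 3 L))
    [DecidableRel G₁.Adj] (c₀ e₀ : BoxVertex 3 L)
    (p : Current (freeBoxGraph 3 L) × Current (freeBoxGraph 3 L)) :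
    {q : Current (freeBoxGraph 3 L) × Current (freeBoxGraph 3 L) |
        liftBonds 3 L ((q.1 + q.2).tracedIn G₁) ∉ openConn (c₀ : Site 3) (e₀ : Site 3)}.indicator
      (1 : Current (freeBoxGraph 3 L) × Current (freeBoxGraph 3 L) → ℝ≥0∞) p =
      (Current.connIn G₁ c₀ e₀)ᶜ.indicator 1 (p.1 + p.2) := by
  have hiff : p ∈ {q : Current (freeBoxGraph 3 L) × Current (freeBoxGraph 3 L) |
      liftBonds 3 L ((q.1 + q.2).tracedIn G₁) ∉ openConn (c₀ : Site 3) (e₀ : Site 3)} ↔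
      p.1 + p.2 ∈ (Current.connIn G₁ c₀ e₀)ᶜ := by
    rw [Set.mem_setOf_eq, Set.mem_compl_iff, liftBonds_mem_openConn_iff]
    exact Iff.rfl
  by_cases h : p.1 + p.2 ∈ (Current.connIn G₁ c₀ e₀)ᶜ
  · rw [Set.indicator_of_mem h, Set.indicator_of_mem (hiff.2 h), Pi.one_apply, Pi.one_apply]
  · rw [Set.indicator_of_notMem h, Set.indicator_of_notMem fun h' => h (hiff.1 h')]

/-- **The essentiality criterion, box-vertex form** (nested switching lemma, ADS15 Lemma 2.2, with the
sourceless current on the depleted graph `G₁ = offGraph Λ_L T`, `T = boxSources 3 L C`, and the sourced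
one on `Λ_L`): if `c' Z_{G₁}[∅] Z[ce] ≤ DISC = ∑ 𝟙[n₁ ⊆ E(G₁), ∂n₁ = ∅] 𝟙[∂n₂ = {c}∆{e}] w w 𝟙[c ↮ e in E(G₁)]`,
then `⟨σ_cσ_e⟩_{Λ_L∖C} ≤ (1 − c')⟨σ_cσ_e⟩_{Λ_L}`. Proof: `Z_{G₁}[∅] Z[ce] = Z_{G₁}[ce] Z[∅] + DISC`
(`Current.ecurrentSumIn_empty_mul_ecurrentSum_pair`), then the box dictionary and division by
`Z_{G₁}[∅] Z[∅] > 0`. [cite: AizenmanDuminilCopinSidoraviciusCMP2015, Lemma 2.2] -/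
theorem defectG_le_of_disconnection (L : ℕ) (K : (freeBoxGraph 3 L).edgeFinset → ℝ)
    (hKβ : K = fun _ => criticalBeta 3) (C : Finset (Site 3)) (c₀ e₀ : BoxVertex 3 L)
    (hc : (c₀ : Site 3) ∈ box 3 L) (he : (e₀ : Site 3) ∈ box 3 L) (hcC : (c₀ : Site 3) ∉ C)
    (heC : (e₀ : Site 3) ∉ C) {c' : ℝ} (hc'0 : 0 ≤ c')
    (hyp : ENNReal.ofReal c' *
        ecurrentSumIn (offGraph (freeBoxGraph 3 L) (boxSources 3 L C)) K ∅ *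
        ecurrentSum K ({c₀} ∆ {e₀}) ≤
      ∑' p : Current (freeBoxGraph 3 L) × Current (freeBoxGraph 3 L),
        (if Current.IsSupp (offGraph (freeBoxGraph 3 L) (boxSources 3 L C)) p.1 ∧ p.1.sources = ∅
          then p.1.eweight K else 0) *
        (if p.2.sources = {c₀} ∆ {e₀} then p.2.eweight K else 0) *
        (Current.connIn (offGraph (freeBoxGraph 3 L) (boxSources 3 L C)) c₀ e₀)ᶜ.indicator 1
          (p.1 + p.2)) :
    defectG L C c₀ e₀ ≤ (1 - c') * boxG L c₀ e₀ := by
  have hβ : 0 ≤ criticalBeta 3 := criticalBeta_nonneg 3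
  have hK : ∀ e', 0 ≤ K e' := fun _ => by rw [hKβ]; exact hβ
  have hcT : c₀ ∉ boxSources 3 L C := fun h => hcC (mem_boxSources_iff.1 h)
  have heT : e₀ ∉ boxSources 3 L C := fun h => heC (mem_boxSources_iff.1 h)
  -- the identity of the nested switching lemma, and the core inequality in `ℝ≥0∞`
  have hcore :
      ecurrentSumIn (offGraph (freeBoxGraph 3 L) (boxSources 3 L C)) K ({c₀} ∆ {e₀}) *
          ecurrentSum K ∅ +
        ENNReal.ofReal c' *
          ecurrentSumIn (offGraph (freeBoxGraph 3 L) (boxSources 3 L C)) K ∅ *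
          ecurrentSum K ({c₀} ∆ {e₀}) ≤
      ecurrentSumIn (offGraph (freeBoxGraph 3 L) (boxSources 3 L C)) K ∅ *
        ecurrentSum K ({c₀} ∆ {e₀}) :=
    calc _ ≤ ecurrentSumIn (offGraph (freeBoxGraph 3 L) (boxSources 3 L C)) K ({c₀} ∆ {e₀}) *
          ecurrentSum K ∅ + _ := add_le_add le_rfl hyp
      _ = _ := (Current.ecurrentSumIn_empty_mul_ecurrentSum_pair _ hK c₀ e₀).symm
  -- pass to the reals
  have h1top : ecurrentSumIn (offGraph (freeBoxGraph 3 L) (boxSources 3 L C)) K ∅ ≠ ∞ :=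
    ecurrentSumIn_ne_top _ hK _
  have h2top : ecurrentSumIn (offGraph (freeBoxGraph 3 L) (boxSources 3 L C)) K ({c₀} ∆ {e₀}) ≠ ∞ :=
    ecurrentSumIn_ne_top _ hK _
  have hZtop : ∀ S, ecurrentSum K S ≠ ∞ := fun S => ecurrentSum_ne_top hK S
  have hb : 0 < (ecurrentSumIn (offGraph (freeBoxGraph 3 L) (boxSources 3 L C)) K ∅).toReal :=
    ENNReal.toReal_pos (lt_of_lt_of_le zero_lt_one (one_le_ecurrentSumIn_empty _ K)).ne' h1top
  have hz0 : 0 < (ecurrentSum K ∅).toReal :=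
    ENNReal.toReal_pos (ecurrentSum_empty_ne_zero K) (hZtop _)
  have hreal := ENNReal.toReal_mono (ENNReal.mul_ne_top h1top (hZtop _)) hcore
  rw [ENNReal.toReal_add (ENNReal.mul_ne_top h2top (hZtop _))
      (ENNReal.mul_ne_top (ENNReal.mul_ne_top ENNReal.ofReal_ne_top h1top) (hZtop _)),
    ENNReal.toReal_mul, ENNReal.toReal_mul, ENNReal.toReal_mul, ENNReal.toReal_mul,
    ENNReal.toReal_ofReal hc'0] at hreal
  -- the box dictionary
  rw [← defectG_map_boxSources L C, ← toReal_offRatio_eq_defectG L K hKβ _ c₀ e₀ hc he hcT heT,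
    boxG_eq_toReal_div L K hKβ c₀ e₀ hc he, Current.offRatio, ENNReal.toReal_div, ← mul_div_assoc,
    div_le_div_iff₀ hb hz0]
  linarith

/-- **Registered stub `stub_essentialityCriterion` — THE ESSENTIALITY CRITERION** (line
`merging-is-expected-screening` of crux stmt-CriticalPhenomena-13885; nested switching lemma of
Aizenman–Duminil-Copin–Sidoravicius 2015, Lemma 2.2, free box `Λ_L ⊂ ℤ³` at `β_c(3)`): for
`c, e ∈ Λ_L` outside `C` and `0 ≤ c'`, if the disconnection mass
`DISC = ∑ 𝟙[n₁ ⊆ E(Λ_L∖C), ∂n₁ = ∅] w(n₁) 𝟙[∂n₂ = {c}∆{e}] w(n₂) 𝟙[c ↮ e through (n₁+n₂)|_{E(Λ_L∖C)}]`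
is at least `c' · Z_{Λ_L∖C}[∅] · Z_{Λ_L}[ce]` — i.e. `C` is essential for `c ↔ e` in
`P^{∅}_{Λ_L∖C} ⊗ P^{ce}_{Λ_L}` with probability `≥ c'` — then `C` depletes:
`⟨σ_cσ_e⟩_{Λ_L∖C} ≤ (1 − c')⟨σ_cσ_e⟩_{Λ_L}`. Proof: `defectG_le_of_disconnection` at the box vertices
of `c, e` (`boxSources_pair`, `indicator_liftBonds_notMem_openConn`).
[cite: AizenmanDuminilCopinSidoraviciusCMP2015, Lemma 2.2] -/
theorem stub_essentialityCriterion :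
    ∀ (L : ℕ) (C : Finset (Site 3)) (c e : Site 3), c ∈ box 3 L → e ∈ box 3 L → c ∉ C → e ∉ C →
      ∀ c' : ℝ, 0 ≤ c' →
      ENNReal.ofReal c' *
          ecurrentSumIn (offGraph (freeBoxGraph 3 L) (boxSources 3 L C))
            (fun _ : (freeBoxGraph 3 L).edgeFinset => criticalBeta 3) ∅ *
          ecurrentSum (fun _ : (freeBoxGraph 3 L).edgeFinset => criticalBeta 3)
            (boxSources 3 L ({c} ∆ {e})) ≤
        ∑' p : Current (freeBoxGraph 3 L) × Current (freeBoxGraph 3 L),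
          (if Current.IsSupp (offGraph (freeBoxGraph 3 L) (boxSources 3 L C)) p.1 ∧ p.1.sources = ∅
            then p.1.eweight (fun _ : (freeBoxGraph 3 L).edgeFinset => criticalBeta 3) else 0) *
          (if p.2.sources = boxSources 3 L ({c} ∆ {e})
            then p.2.eweight (fun _ : (freeBoxGraph 3 L).edgeFinset => criticalBeta 3) else 0) *
          {q : Current (freeBoxGraph 3 L) × Current (freeBoxGraph 3 L) |
              liftBonds 3 L ((q.1 + q.2).tracedIn (offGraph (freeBoxGraph 3 L) (boxSources 3 L C))) ∉
                openConn c e}.indicator 1 p →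
      defectG L C c e ≤ (1 - c') * boxG L c e := by
  intro L C c e hc he hcC heC c' hc'0 hyp
  -- box vertices of `c, e`
  have hl : ∀ x ∈ box 3 L, ∃ x' : BoxVertex 3 L, (x' : Site 3) = x := fun x hx =>
    ⟨⟨x, box_subset_box_succ 3 L hx⟩, rfl⟩
  obtain ⟨⟨c₀, rfl⟩, ⟨e₀, rfl⟩⟩ := And.intro (hl c hc) (hl e he)
  rw [boxSources_pair] at hyp
  have hsum : (∑' p : Current (freeBoxGraph 3 L) × Current (freeBoxGraph 3 L),
      (if Current.IsSupp (offGraph (freeBoxGraph 3 L) (boxSources 3 L C)) p.1 ∧ p.1.sources = ∅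
        then p.1.eweight (fun _ : (freeBoxGraph 3 L).edgeFinset => criticalBeta 3) else 0) *
      (if p.2.sources = ({c₀} : Finset (BoxVertex 3 L)) ∆ {e₀}
        then p.2.eweight (fun _ : (freeBoxGraph 3 L).edgeFinset => criticalBeta 3) else 0) *
      {q : Current (freeBoxGraph 3 L) × Current (freeBoxGraph 3 L) |
          liftBonds 3 L ((q.1 + q.2).tracedIn (offGraph (freeBoxGraph 3 L) (boxSources 3 L C))) ∉
            openConn (c₀ : Site 3) (e₀ : Site 3)}.indicator 1 p) =
      ∑' p : Current (freeBoxGraph 3 L) × Current (freeBoxGraph 3 L),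
        (if Current.IsSupp (offGraph (freeBoxGraph 3 L) (boxSources 3 L C)) p.1 ∧ p.1.sources = ∅
          then p.1.eweight (fun _ : (freeBoxGraph 3 L).edgeFinset => criticalBeta 3) else 0) *
        (if p.2.sources = ({c₀} : Finset (BoxVertex 3 L)) ∆ {e₀}
          then p.2.eweight (fun _ : (freeBoxGraph 3 L).edgeFinset => criticalBeta 3) else 0) *
        (Current.connIn (offGraph (freeBoxGraph 3 L) (boxSources 3 L C)) c₀ e₀)ᶜ.indicator 1
          (p.1 + p.2) :=
    tsum_congr fun p => by rw [indicator_liftBonds_notMem_openConn]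
  rw [hsum] at hyp
  exact defectG_le_of_disconnection L _ rfl C c₀ e₀ hc he hcC heC hc'0 hyp

end Summit.CriticalPhenomena.Ising3DConformalLimit.Cruxes.CoulombImpliesNontrivial.MergingIsExpectedScreening

end
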